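import Literature.Analysis.FluidPDE.LocalLeraySlabH1Pairing
import Literature.Analysis.FluidPDE.LocalLerayFarFieldDifference
import Literature.Analysis.FluidPDE.CKNVelocityIntegrability
import Literature.Analysis.FunctionSpaces.TimeMollification
import HarnessLib

/-!
# Local Leray solutions: slice norms on a finite cylinder `(0,T) × K`

Analysis/FluidPDE theorem file (no definitions). Bookkeeping for the weak–strong uniqueness
argument of Lemarié-Rieusset 2016, Thm. 14.7 (proof, pp. 515–516): the bulk terms of the
`u₁ · u₂` balance are doubled (time-mollified) pairings of slices of local Leray solutions, whose
limits (`FunctionSpaces.tendsto_doubledPairing_of_ae_le`, `…_of_rpow`) require the slices to lie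
in the mixed Lebesgue spaces `L^∞_t L²_x`, `L²_t L⁶_x`, `L³_t L³_x` (velocity), `L²_t L²_x`
(gradient), `L^{3/2}_t L^{3/2}_x` (pressure) on every compact `K` — Lemarié-Rieusset 2016,
Def. 14.1 and (13.17)–(13.18). This file records these facts in the form
`∫ ‖v(t,·)‖_{L^q(K)}^p dt < ∞` for the product measure `dt|_{(0,T)} ⊗ dx|_K`, together with
the Hölder inequalities for slices of products `G(t,x) u(t,x)` and the exponent instances
`(2,3,6/5)`, `(2,6,3/2)`, `(6/5,6)`, `(3/2,3)`.

## Main results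

* `IsLocalLeraySolutionOn.exists_ae_eLpNorm_slice_two_le` (`L^∞_t L²_x`),
  `.lintegral_eLpNorm_slice_two_lt_top`, `.lintegral_eLpNorm_slice_three_lt_top` (`L³_t L³_x`),
  `.lintegral_eLpNorm_pressure_slice_lt_top` (`L^{3/2}`), `.lintegral_eLpNorm_grad_slice_lt_top`
  (`L²_t L²_x` for any weak gradient), `.lintegral_eLpNorm_slice_six_sq_lt_top` (`L²_t L⁶_x`,
  Sobolev on balls, `exists_eLpNorm_six_le_ball`).
* `eLpNorm_clm_apply_le_mul_eLpNorm` and the instances `holderTriple_two_three_sixFifths` (the triple `(2,6,3/2)` is the tree's `holderTriple_two_six`, `TsaiBootstrapTools`),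
  `holderConjugate_sixFifths_six`, `holderConjugate_threeHalves_three`.
* `ae_eLpNorm_sub_slice_three_le` — the slice bound `‖(u₁ - u₃)(t)‖_{L³} ≤ ε` from the
  splitting `u₁ = u₃ + u₄` a.e. with `‖u₄(t)‖_{L³} ≤ ε`.

## Mathlib / tree search

Tree: `IsLocalLeraySolutionOn.aestronglyMeasurable_prod_restrict` (`LocalLerayFarFieldDifference`), `IsLocalLeraySolutionOn` (clauses `sqIntegrable`, `pressure`, `uniformLocalEnergy`,
`uniformLocalGradient`), `lintegral_cube_box_lt_top`, `integrableOn_pressure`,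
`integrableOn_cylinder_of_lintegral_sq_slab`, `ae_slice_aestronglyMeasurable_and_lintegral_ball_lt_top`,
`HasWeakSpatialGradientOn.ae_hasWeakFDerivOn_slice_slab`, `.ae_eq`, `exists_eLpNorm_six_le_ball`,
`enorm_opNorm_sq_le_ofReal_frobeniusNormSq`, `FunctionSpaces.aemeasurable_eLpNorm_slice`.
Mathlib: `eLpNorm_le_eLpNorm_mul_eLpNorm'_of_norm`, `lintegral_prod`, `Measure.prod_restrict`.

## References

* P. G. Lemarié-Rieusset, *The Navier–Stokes Problem in the 21st Century*, CRC Press 2016,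
  doi:10.1201/b19556: Def. 14.1 p. 487, (13.17)–(13.18) p. 461, proof of Thm. 14.7 p. 515.
  [LemarieRieusset2016]
-/

noncomputable section

open MeasureTheory TopologicalSpace Set Function Filter Metric
open _root_.Topology
open scoped ENNReal NNReal RealInnerProductSpace

namespace Literature.Analysis.FluidPDE

open FunctionSpaces

/-! ## Exponent bookkeeping -/

section Exponents

/-- `1/2 + 1/3 = 5/6`: the Hölder triple `(2, 3, 6/5)`. [folklore] -/
theorem holderTriple_two_three_sixFifths : ENNReal.HolderTriple 2 3 (ENNReal.ofReal (6 / 5)) := by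
  have h := holderTriple_ofReal (a := 2) (b := 3) (c := 6 / 5) (by norm_num) (by norm_num) (by norm_num)
    (by norm_num)
  simpa using h

/-- The conjugate exponents `(6/5, 6)`. [folklore] -/
theorem holderConjugate_sixFifths_six : ENNReal.HolderConjugate (ENNReal.ofReal (6 / 5)) 6 := by
  have h := holderTriple_ofReal (a := 6 / 5) (b := 6) (c := 1) (by norm_num) (by norm_num) (by norm_num)
    (by norm_num)
  simpa using h

/-- The conjugate exponents `(3/2, 3)`. [folklore] -/
theorem holderConjugate_threeHalves_three : ENNReal.HolderConjugate (ENNReal.ofReal (3 / 2)) 3 := by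
  have h := holderTriple_ofReal (a := 3 / 2) (b := 3) (c := 1) (by norm_num) (by norm_num) (by norm_num)
    (by norm_num)
  simpa using h

end Exponents

/-! ## Hölder for slices of products -/

section SliceHolder

variable {α : Type*} [MeasurableSpace α] {κ : Measure α}
variable {E F : Type*} [NormedAddCommGroup E] [NormedSpace ℝ E] [NormedAddCommGroup F] [NormedSpace ℝ F]

/-- **Hölder for the pointwise application of a field of linear maps**:
`‖x ↦ L(x) u(x)‖_{L^r} ≤ ‖L‖_{L^p} ‖u‖_{L^q}` for `1/p + 1/q = 1/r`. [folklore] -/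
theorem eLpNorm_clm_apply_le_mul_eLpNorm {L : α → E →L[ℝ] F} {u : α → E}
    (hL : AEStronglyMeasurable L κ) (hu : AEStronglyMeasurable u κ) (p q r : ℝ≥0∞)
    [ENNReal.HolderTriple p q r] :
    eLpNorm (fun x => L x (u x)) r κ ≤ eLpNorm L p κ * eLpNorm u q κ := by
  have := eLpNorm_le_eLpNorm_mul_eLpNorm'_of_norm (p := p) (q := q) (r := r) hL hu
    (fun (M : E →L[ℝ] F) (v : E) => M v) 1 (Eventually.of_forall fun x => by
      rw [NNReal.coe_one, one_mul]; exact ContinuousLinearMap.le_opNorm _ _)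
  simpa using this

/-- Scalar weights bounded by `C` cost a factor `C` in every `L^p` norm. [folklore] -/
theorem eLpNorm_smul_le_of_norm_le {c : α → ℝ} {C : ℝ} (hc : ∀ x, ‖c x‖ ≤ C) (f : α → F)
    (p : ℝ≥0∞) : eLpNorm (fun x => c x • f x) p κ ≤ ENNReal.ofReal C * eLpNorm f p κ :=
  eLpNorm_le_mul_eLpNorm_of_ae_le_mul (Eventually.of_forall fun x => by
    rw [norm_smul]; exact mul_le_mul_of_nonneg_right (hc x) (norm_nonneg _)) p

/-- Applying a field of linear maps to a bounded vector field costs the bound. [folklore] -/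
theorem eLpNorm_clm_apply_le_of_norm_le {L : α → E →L[ℝ] F} {c : α → E} {C : ℝ}
    (hc : ∀ x, ‖c x‖ ≤ C) (p : ℝ≥0∞) :
    eLpNorm (fun x => L x (c x)) p κ ≤ ENNReal.ofReal C * eLpNorm L p κ :=
  eLpNorm_le_mul_eLpNorm_of_ae_le_mul (Eventually.of_forall fun x => by
    calc ‖L x (c x)‖ ≤ ‖L x‖ * ‖c x‖ := ContinuousLinearMap.le_opNorm _ _
      _ ≤ ‖L x‖ * C := mul_le_mul_of_nonneg_left (hc x) (norm_nonneg _)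
      _ = C * ‖L x‖ := mul_comm _ _) p

end SliceHolder

/-! ## Tonelli for slice norms -/

section Tonelli

variable {X : Type*} [MeasurableSpace X] {W : Type*} [NormedAddCommGroup W]

/-- **Tonelli for slice norms**: `∫ ‖F(t,·)‖_{L^q}^q dt = ∫∫ ‖F‖^q` (`0 < q < ∞`). [folklore] -/
theorem lintegral_eLpNorm_slice_rpow_eq {ν : Measure ℝ} {κ : Measure X} [SFinite ν] [SFinite κ]
    {F : ℝ → X → W} (hF : AEStronglyMeasurable (uncurry F) (ν.prod κ)) {q : ℝ≥0∞}
    (hq0 : q ≠ 0) (hq : q ≠ ∞) :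
    ∫⁻ t, eLpNorm (F t) q κ ^ q.toReal ∂ν = ∫⁻ z, ‖uncurry F z‖ₑ ^ q.toReal ∂(ν.prod κ) := by
  have hqr : 0 < q.toReal := ENNReal.toReal_pos hq0 hq
  rw [lintegral_prod _ (hF.enorm.pow_const _)]
  refine lintegral_congr fun t => ?_
  rw [eLpNorm_eq_lintegral_rpow_enorm_toReal hq0 hq, ← ENNReal.rpow_mul, one_div_mul_cancel hqr.ne',
    ENNReal.rpow_one]
  rfl

end Tonelli

/-! ## The cylinder `(0,T) × K` -/

/-- The product of the restricted measures is the restriction to the cylinder. [folklore] -/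
theorem prod_restrict_eq_restrict_cylinder (T : ℝ) (K : Set (EuclideanSpace ℝ (Fin 3))) :
    ((volume : Measure ℝ).restrict (Ioo 0 T)).prod ((volume : Measure (EuclideanSpace ℝ (Fin 3))).restrict K) =
      (volume : Measure (ℝ × EuclideanSpace ℝ (Fin 3))).restrict (Ioo 0 T ×ˢ K) := by
  rw [Measure.prod_restrict, ← Measure.volume_eq_prod]

/-- `(a + b)² ≤ 4 (a² + b²)` in `ℝ≥0∞`. [folklore] -/
theorem ennreal_add_rpow_two_le (a b : ℝ≥0∞) : (a + b) ^ (2 : ℝ) ≤ 4 * (a ^ (2 : ℝ) + b ^ (2 : ℝ)) := by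
  rw [ENNReal.rpow_two, ENNReal.rpow_two, ENNReal.rpow_two]
  have h1 : a + b ≤ 2 * max a b := by
    rw [two_mul]; exact add_le_add (le_max_left _ _) (le_max_right _ _)
  have h2 : max a b ^ 2 ≤ a ^ 2 + b ^ 2 := by
    rcases le_total a b with h | h
    · rw [max_eq_right h]; exact le_add_self
    · rw [max_eq_left h]; exact le_self_add
  calc (a + b) ^ 2 ≤ (2 * max a b) ^ 2 := pow_le_pow_left' h1 2
    _ = 4 * max a b ^ 2 := by rw [mul_pow]; norm_num
    _ ≤ 4 * (a ^ 2 + b ^ 2) := mul_le_mul' le_rfl h2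

/-- `|L|²_F ≤ 3 ‖L‖²` on `ℝ³` (three columns, each of norm at most `‖L‖`). [folklore] -/
theorem frobeniusNormSq_le_three_mul_norm_sq {F : Type*} [NormedAddCommGroup F] [InnerProductSpace ℝ F]
    [FiniteDimensional ℝ F] (L : EuclideanSpace ℝ (Fin 3) →L[ℝ] F) :
    frobeniusNormSq L ≤ 3 * ‖L‖ ^ 2 := by
  unfold frobeniusNormSq
  calc ∑ i, ‖L (stdOrthonormalBasis ℝ (EuclideanSpace ℝ (Fin 3)) i)‖ ^ 2
      ≤ ∑ _i : Fin (Module.finrank ℝ (EuclideanSpace ℝ (Fin 3))), ‖L‖ ^ 2 := by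
        refine Finset.sum_le_sum fun i _ => ?_
        have h := L.le_opNorm (stdOrthonormalBasis ℝ (EuclideanSpace ℝ (Fin 3)) i)
        rw [(stdOrthonormalBasis ℝ (EuclideanSpace ℝ (Fin 3))).orthonormal.1 i, mul_one] at h
        exact pow_le_pow_left₀ (norm_nonneg _) h 2
    _ = 3 * ‖L‖ ^ 2 := by
        rw [Finset.sum_const, Finset.card_univ, Fintype.card_fin, finrank_euclideanSpace_fin]
        simp

namespace IsLocalLeraySolutionOn

variable {T ν : ℝ} {v₀ : EuclideanSpace ℝ (Fin 3) → EuclideanSpace ℝ (Fin 3)}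
  {v : ℝ → EuclideanSpace ℝ (Fin 3) → EuclideanSpace ℝ (Fin 3)}
  {π : ℝ → EuclideanSpace ℝ (Fin 3) → ℝ}

/-- The pressure of a local Leray solution is a.e.-jointly measurable on every compact cylinder.
[folklore] -/
theorem aestronglyMeasurable_pressure_prod_restrict (h : IsLocalLeraySolutionOn T ν v₀ v π)
    {K : Set (EuclideanSpace ℝ (Fin 3))} (hK : IsCompact K) :
    AEStronglyMeasurable (uncurry π)
      (((volume : Measure ℝ).restrict (Ioo 0 T)).prod ((volume : Measure (EuclideanSpace ℝ (Fin 3))).restrict K)) := by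
  rw [prod_restrict_eq_restrict_cylinder]
  exact (h.integrableOn_pressure hK).aestronglyMeasurable

/-- A weak spatial gradient on the slab is a.e.-jointly measurable on every cylinder. [folklore] -/
theorem _root_.Literature.Analysis.FluidPDE.HasWeakSpatialGradientOn.aestronglyMeasurable_prod_restrict
    {G : ℝ → EuclideanSpace ℝ (Fin 3) → EuclideanSpace ℝ (Fin 3) →L[ℝ] EuclideanSpace ℝ (Fin 3)}
    (hG : HasWeakSpatialGradientOn (slab (EuclideanSpace ℝ (Fin 3)) (Ioo 0 T) isOpen_Ioo) v G)
    (K : Set (EuclideanSpace ℝ (Fin 3))) :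
    AEStronglyMeasurable (uncurry G)
      (((volume : Measure ℝ).restrict (Ioo 0 T)).prod ((volume : Measure (EuclideanSpace ℝ (Fin 3))).restrict K)) := by
  have hstrip : ((slab (EuclideanSpace ℝ (Fin 3)) (Ioo 0 T) isOpen_Ioo :
      Opens (ℝ × EuclideanSpace ℝ (Fin 3))) : Set (ℝ × EuclideanSpace ℝ (Fin 3))) = Ioo (0 : ℝ) T ×ˢ univ := rfl
  have h1 : AEStronglyMeasurable (uncurry G) (volume.restrict (Ioo (0 : ℝ) T ×ˢ univ)) := by
    rw [← hstrip]; exact hG.locallyIntegrableOn_grad.aestronglyMeasurable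
  rw [prod_restrict_eq_restrict_cylinder]
  exact h1.mono_measure (Measure.restrict_mono (prod_mono Subset.rfl (subset_univ _)) le_rfl)

/-- A local Leray solution is integrable on every compact cylinder. [folklore] -/
theorem integrable_prod_restrict (h : IsLocalLeraySolutionOn T ν v₀ v π)
    {K : Set (EuclideanSpace ℝ (Fin 3))} (hK : IsCompact K) :
    Integrable (uncurry v)
      (((volume : Measure ℝ).restrict (Ioo 0 T)).prod ((volume : Measure (EuclideanSpace ℝ (Fin 3))).restrict K)) := by
  rw [prod_restrict_eq_restrict_cylinder]
  exact (integrableOn_cylinder_of_lintegral_sq_slab h.aestronglyMeasurable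
    (fun K' hK' => h.sqIntegrable K' hK') hK).1

/-- **`L^∞_t L²_x` on a compact set**: `‖v(t,·)‖_{L²(K)} ≤ C < ∞` for a.e. `t ∈ (0,T)`
(Lemarié-Rieusset 2016, Def. 14.1: `v ∈ (L^∞_t L²_x)_{uloc}`). [cite: LemarieRieusset2016, Def. 14.1 p. 487] -/
theorem exists_ae_eLpNorm_slice_two_le (h : IsLocalLeraySolutionOn T ν v₀ v π)
    {K : Set (EuclideanSpace ℝ (Fin 3))} (hK : IsCompact K) :
    ∃ C : ℝ≥0∞, C ≠ ∞ ∧ ∀ᵐ t ∂((volume : Measure ℝ).restrict (Ioo 0 T)),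
      eLpNorm (v t) 2 ((volume : Measure (EuclideanSpace ℝ (Fin 3))).restrict K) ≤ C := by
  obtain ⟨r, hr0, hKr⟩ := hK.isBounded.subset_ball_lt 0 (0 : EuclideanSpace ℝ (Fin 3))
  obtain ⟨C, hC⟩ := h.uniformLocalEnergy r hr0
  refine ⟨(C : ℝ≥0∞) ^ (1 / 2 : ℝ), ENNReal.rpow_ne_top_of_nonneg (by norm_num) ENNReal.coe_ne_top, ?_⟩
  filter_upwards [hC] with t ht
  rw [eLpNorm_eq_lintegral_rpow_enorm_toReal two_ne_zero ENNReal.ofNat_ne_top, ENNReal.toReal_ofNat]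
  refine ENNReal.rpow_le_rpow ?_ (by norm_num)
  calc ∫⁻ x in K, ‖v t x‖ₑ ^ (2 : ℝ) ≤ ∫⁻ x in ball (0 : EuclideanSpace ℝ (Fin 3)) r, ‖v t x‖ₑ ^ (2 : ℝ) :=
        lintegral_mono_set hKr
    _ = ∫⁻ x in ball (0 : EuclideanSpace ℝ (Fin 3)) r, ‖v t x‖ₑ ^ 2 := by simp_rw [ENNReal.rpow_two]
    _ ≤ C := ht 0

/-- **`L²_t L²_x` on a compact cylinder**: `∫ ‖v(t,·)‖²_{L²(K)} dt < ∞`. [folklore] -/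
theorem lintegral_eLpNorm_slice_two_lt_top (h : IsLocalLeraySolutionOn T ν v₀ v π)
    {K : Set (EuclideanSpace ℝ (Fin 3))} (hK : IsCompact K) :
    ∫⁻ t, eLpNorm (v t) 2 ((volume : Measure (EuclideanSpace ℝ (Fin 3))).restrict K) ^ (2 : ℝ)
      ∂((volume : Measure ℝ).restrict (Ioo 0 T)) < ∞ := by
  have h1 := lintegral_eLpNorm_slice_rpow_eq (h.aestronglyMeasurable_prod_restrict K) two_ne_zero
    ENNReal.ofNat_ne_top
  rw [ENNReal.toReal_ofNat] at h1
  rw [h1, prod_restrict_eq_restrict_cylinder]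
  simp only [ENNReal.rpow_two]
  exact h.sqIntegrable K hK

/-- **`L³_t L³_x` on a compact cylinder**: `∫ ‖v(t,·)‖³_{L³(K)} dt < ∞`
(Lemarié-Rieusset 2016, (13.18)). [cite: LemarieRieusset2016, (13.18) p. 461] -/
theorem lintegral_eLpNorm_slice_three_lt_top (h : IsLocalLeraySolutionOn T ν v₀ v π)
    {K : Set (EuclideanSpace ℝ (Fin 3))} (hK : IsCompact K) :
    ∫⁻ t, eLpNorm (v t) 3 ((volume : Measure (EuclideanSpace ℝ (Fin 3))).restrict K) ^ (3 : ℝ)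
      ∂((volume : Measure ℝ).restrict (Ioo 0 T)) < ∞ := by
  obtain ⟨r, -, hKr⟩ := hK.isBounded.subset_ball_lt 0 (0 : EuclideanSpace ℝ (Fin 3))
  have h1 := lintegral_eLpNorm_slice_rpow_eq (h.aestronglyMeasurable_prod_restrict K)
    (by norm_num : (3 : ℝ≥0∞) ≠ 0) ENNReal.ofNat_ne_top
  rw [ENNReal.toReal_ofNat] at h1
  rw [h1, prod_restrict_eq_restrict_cylinder]
  calc ∫⁻ z in Ioo 0 T ×ˢ K, ‖uncurry v z‖ₑ ^ (3 : ℝ)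
      ≤ ∫⁻ z in Ioo 0 T ×ˢ ball (0 : EuclideanSpace ℝ (Fin 3)) r, ‖v z.1 z.2‖ₑ ^ (3 : ℕ) := by
        refine (lintegral_mono_set (prod_mono Subset.rfl hKr)).trans (lintegral_mono fun z => le_of_eq ?_)
        rw [← ENNReal.rpow_natCast]; rfl
    _ < ∞ := h.lintegral_cube_box_lt_top 0 r

/-- **`L^{3/2}` pressure on a compact cylinder**: `∫ ‖π(t,·)‖^{3/2}_{L^{3/2}(K)} dt < ∞`
(Lemarié-Rieusset 2016, Def. 14.1). [cite: LemarieRieusset2016, Def. 14.1 p. 487] -/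
theorem lintegral_eLpNorm_pressure_slice_lt_top (h : IsLocalLeraySolutionOn T ν v₀ v π)
    {K : Set (EuclideanSpace ℝ (Fin 3))} (hK : IsCompact K) :
    ∫⁻ t, eLpNorm (π t) (ENNReal.ofReal (3 / 2)) ((volume : Measure (EuclideanSpace ℝ (Fin 3))).restrict K) ^ (3 / 2 : ℝ)
      ∂((volume : Measure ℝ).restrict (Ioo 0 T)) < ∞ := by
  have h32 : (ENNReal.ofReal (3 / 2)).toReal = 3 / 2 := ENNReal.toReal_ofReal (by norm_num)
  have h1 := lintegral_eLpNorm_slice_rpow_eq (h.aestronglyMeasurable_pressure_prod_restrict hK)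
    (by simp : ENNReal.ofReal (3 / 2) ≠ 0) ENNReal.ofReal_ne_top
  rw [h32] at h1
  rw [h1, prod_restrict_eq_restrict_cylinder]
  exact h.pressure K hK

/-- **`L²_t L²_x` for any weak gradient on a compact cylinder**: `∫ ‖G(t,·)‖²_{L²(K)} dt < ∞`
(the gradient of clause (2) of Def. 14.1 and uniqueness of weak gradients a.e.).
[cite: LemarieRieusset2016, Def. 14.1 p. 487] -/
theorem lintegral_eLpNorm_grad_slice_lt_top (h : IsLocalLeraySolutionOn T ν v₀ v π)
    {G : ℝ → EuclideanSpace ℝ (Fin 3) → EuclideanSpace ℝ (Fin 3) →L[ℝ] EuclideanSpace ℝ (Fin 3)}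
    (hG : HasWeakSpatialGradientOn (slab (EuclideanSpace ℝ (Fin 3)) (Ioo 0 T) isOpen_Ioo) v G)
    {K : Set (EuclideanSpace ℝ (Fin 3))} (hK : IsCompact K) :
    ∫⁻ t, eLpNorm (G t) 2 ((volume : Measure (EuclideanSpace ℝ (Fin 3))).restrict K) ^ (2 : ℝ)
      ∂((volume : Measure ℝ).restrict (Ioo 0 T)) < ∞ := by
  obtain ⟨r, hr0, hKr⟩ := hK.isBounded.subset_ball_lt 0 (0 : EuclideanSpace ℝ (Fin 3))
  obtain ⟨G', hG', hG'b⟩ := h.uniformLocalGradient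
  obtain ⟨C', hC'⟩ := hG'b r hr0
  have hstrip : ((slab (EuclideanSpace ℝ (Fin 3)) (Ioo 0 T) isOpen_Ioo :
      Opens (ℝ × EuclideanSpace ℝ (Fin 3))) : Set (ℝ × EuclideanSpace ℝ (Fin 3))) = Ioo (0 : ℝ) T ×ˢ univ := rfl
  have hae : ∀ᵐ z ∂(volume.restrict (Ioo (0 : ℝ) T ×ˢ ball (0 : EuclideanSpace ℝ (Fin 3)) r)),
      uncurry G z = uncurry G' z := by
    have h1 := hG.ae_eq hG'
    rw [hstrip] at h1
    exact ae_restrict_of_ae_restrict_of_subset (prod_mono Subset.rfl (subset_univ _)) h1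
  have h1 := lintegral_eLpNorm_slice_rpow_eq (hG.aestronglyMeasurable_prod_restrict K) two_ne_zero
    ENNReal.ofNat_ne_top
  rw [ENNReal.toReal_ofNat] at h1
  rw [h1, prod_restrict_eq_restrict_cylinder]
  calc ∫⁻ z in Ioo 0 T ×ˢ K, ‖uncurry G z‖ₑ ^ (2 : ℝ)
      ≤ ∫⁻ z in Ioo (0 : ℝ) T ×ˢ ball (0 : EuclideanSpace ℝ (Fin 3)) r, ‖uncurry G z‖ₑ ^ (2 : ℝ) :=
        lintegral_mono_set (prod_mono Subset.rfl hKr)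
    _ ≤ ∫⁻ z in Ioo (0 : ℝ) T ×ˢ ball (0 : EuclideanSpace ℝ (Fin 3)) r,
          ENNReal.ofReal (frobeniusNormSq (G' z.1 z.2)) := by
        refine lintegral_mono_ae ?_
        filter_upwards [hae] with z hz
        rw [hz, ENNReal.rpow_two]
        exact enorm_opNorm_sq_le_ofReal_frobeniusNormSq (G' z.1 z.2)
    _ < ∞ := (hC' 0).trans_lt ENNReal.coe_lt_top

/-- **`L²_t L⁶_x` on a compact cylinder** (Sobolev on a ball containing `K`, for a.e. slice:
Lemarié-Rieusset 2016, (13.17)): `∫ ‖v(t,·)‖²_{L⁶(K)} dt < ∞`.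
[cite: LemarieRieusset2016, (13.17) p. 461] -/
theorem lintegral_eLpNorm_slice_six_sq_lt_top (h : IsLocalLeraySolutionOn T ν v₀ v π)
    {G : ℝ → EuclideanSpace ℝ (Fin 3) → EuclideanSpace ℝ (Fin 3) →L[ℝ] EuclideanSpace ℝ (Fin 3)}
    (hG : HasWeakSpatialGradientOn (slab (EuclideanSpace ℝ (Fin 3)) (Ioo 0 T) isOpen_Ioo) v G)
    {K : Set (EuclideanSpace ℝ (Fin 3))} (hK : IsCompact K) :
    ∫⁻ t, eLpNorm (v t) 6 ((volume : Measure (EuclideanSpace ℝ (Fin 3))).restrict K) ^ (2 : ℝ)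
      ∂((volume : Measure ℝ).restrict (Ioo 0 T)) < ∞ := by
  -- a ball `B = B(0, n)` containing `K`
  obtain ⟨r, -, hKr⟩ := hK.isBounded.subset_ball_lt 0 (0 : EuclideanSpace ℝ (Fin 3))
  set n : ℕ := ⌈r⌉₊ + 1 with hn
  have hrn : r ≤ n := by
    rw [hn]; push_cast; linarith [Nat.le_ceil r]
  have hn0 : (0 : ℝ) < n := by rw [hn]; positivity
  set B : Set (EuclideanSpace ℝ (Fin 3)) := ball 0 n with hB
  have hKB : K ⊆ B := hKr.trans (ball_subset_ball hrn)
  have hBc : B ⊆ closedBall (0 : EuclideanSpace ℝ (Fin 3)) n := ball_subset_closedBall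
  -- Sobolev constant of `B`
  obtain ⟨C, hC⟩ := exists_eLpNorm_six_le_ball (E := EuclideanSpace ℝ (Fin 3)) finrank_euclideanSpace_fin
    (0 : EuclideanSpace ℝ (Fin 3)) n
  -- good slices
  have hmeas : AEStronglyMeasurable (uncurry v)
      ((volume : Measure (ℝ × EuclideanSpace ℝ (Fin 3))).restrict (Ioo 0 T ×ˢ univ)) := h.aestronglyMeasurable
  have hsq : ∀ K' : Set (EuclideanSpace ℝ (Fin 3)), IsCompact K' →
      ∫⁻ z in Ioo 0 T ×ˢ K', ‖uncurry v z‖ₑ ^ 2 < ∞ := fun K' hK' => h.sqIntegrable K' hK'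
  have hgood := ae_slice_aestronglyMeasurable_and_lintegral_ball_lt_top hmeas hsq
  -- the slice bound
  have hslice : ∀ᵐ t ∂((volume : Measure ℝ).restrict (Ioo 0 T)),
      eLpNorm (v t) 6 ((volume : Measure (EuclideanSpace ℝ (Fin 3))).restrict K) ^ (2 : ℝ) ≤
        4 * (C : ℝ≥0∞) ^ (2 : ℝ) * ((∫⁻ x in B, ‖v t x‖ₑ ^ 2) + 3 * ∫⁻ x in B, ‖G t x‖ₑ ^ 2) := by
    filter_upwards [hgood, hG.ae_hasWeakFDerivOn_slice_slab, h.ae_lintegral_grad_sq_ball_lt_top hG]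
      with t h1 h2 h4
    have hw : FunctionSpaces.HasWeakFDerivOn
        (⟨B, isOpen_ball⟩ : Opens (EuclideanSpace ℝ (Fin 3))) volume (v t) (G t) :=
      FunctionSpaces.HasWeakFDerivOn.mono_set_holds h2 le_top
    have hv2 : ∫⁻ x in B, ‖v t x‖ₑ ^ 2 < ∞ := (lintegral_mono_set hBc).trans_lt (h1.2 n)
    have hv2' : eLpNorm (v t) 2 (volume.restrict B) ≠ ∞ := by
      rw [eLpNorm_eq_lintegral_rpow_enorm_toReal two_ne_zero ENNReal.ofNat_ne_top, ENNReal.toReal_ofNat]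
      refine ENNReal.rpow_ne_top_of_nonneg (by norm_num) ?_
      simpa only [ENNReal.rpow_two] using hv2.ne
    have hS := hC (v t) (G t) hw hv2'
    have hfrob : ∫⁻ x in B, ENNReal.ofReal (frobeniusNormSq (G t x)) ≤ 3 * ∫⁻ x in B, ‖G t x‖ₑ ^ 2 := by
      rw [← lintegral_const_mul' _ _ (by simp)]
      refine lintegral_mono fun x => ?_
      calc ENNReal.ofReal (frobeniusNormSq (G t x)) ≤ ENNReal.ofReal (3 * ‖G t x‖ ^ 2) :=
            ENNReal.ofReal_le_ofReal (frobeniusNormSq_le_three_mul_norm_sq _)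
        _ = 3 * ‖G t x‖ₑ ^ 2 := by
            rw [ENNReal.ofReal_mul (by norm_num), ENNReal.ofReal_pow (norm_nonneg _), ofReal_norm]
            simp
    calc eLpNorm (v t) 6 ((volume : Measure (EuclideanSpace ℝ (Fin 3))).restrict K) ^ (2 : ℝ)
        ≤ eLpNorm (v t) 6 (volume.restrict B) ^ (2 : ℝ) :=
          ENNReal.rpow_le_rpow (eLpNorm_mono_measure _ (Measure.restrict_mono hKB le_rfl)) (by norm_num)
      _ ≤ ((C : ℝ≥0∞) * (eLpNorm (v t) 2 (volume.restrict B) +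
            (∫⁻ x in B, ENNReal.ofReal (frobeniusNormSq (G t x))) ^ (1 / 2 : ℝ))) ^ (2 : ℝ) :=
          ENNReal.rpow_le_rpow hS (by norm_num)
      _ = (C : ℝ≥0∞) ^ (2 : ℝ) * (eLpNorm (v t) 2 (volume.restrict B) +
            (∫⁻ x in B, ENNReal.ofReal (frobeniusNormSq (G t x))) ^ (1 / 2 : ℝ)) ^ (2 : ℝ) :=
          ENNReal.mul_rpow_of_nonneg _ _ (by norm_num)
      _ ≤ (C : ℝ≥0∞) ^ (2 : ℝ) * (4 * (eLpNorm (v t) 2 (volume.restrict B) ^ (2 : ℝ) +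
            ((∫⁻ x in B, ENNReal.ofReal (frobeniusNormSq (G t x))) ^ (1 / 2 : ℝ)) ^ (2 : ℝ))) :=
          mul_le_mul' le_rfl (ennreal_add_rpow_two_le _ _)
      _ = 4 * (C : ℝ≥0∞) ^ (2 : ℝ) * ((∫⁻ x in B, ‖v t x‖ₑ ^ 2) +
            ∫⁻ x in B, ENNReal.ofReal (frobeniusNormSq (G t x))) := by
          rw [← ENNReal.rpow_mul, show (1 / 2 : ℝ) * 2 = 1 by norm_num, ENNReal.rpow_one,
            eLpNorm_eq_lintegral_rpow_enorm_toReal two_ne_zero ENNReal.ofNat_ne_top, ENNReal.toReal_ofNat,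
            ← ENNReal.rpow_mul, show (1 / (2 : ℝ)) * 2 = 1 by norm_num, ENNReal.rpow_one]
          simp_rw [ENNReal.rpow_two]
          ring
      _ ≤ _ := by
          refine mul_le_mul' le_rfl (add_le_add le_rfl hfrob)
  -- integrate in `t`
  have hBm : AEStronglyMeasurable (uncurry v)
      (((volume : Measure ℝ).restrict (Ioo 0 T)).prod ((volume : Measure (EuclideanSpace ℝ (Fin 3))).restrict B)) :=
    h.aestronglyMeasurable_prod_restrict B
  have hGBm : AEStronglyMeasurable (uncurry G)
      (((volume : Measure ℝ).restrict (Ioo 0 T)).prod ((volume : Measure (EuclideanSpace ℝ (Fin 3))).restrict B)) :=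
    hG.aestronglyMeasurable_prod_restrict B
  have hIv : ∫⁻ t, (∫⁻ x in B, ‖v t x‖ₑ ^ 2) ∂((volume : Measure ℝ).restrict (Ioo 0 T)) < ∞ := by
    rw [lintegral_lintegral (f := fun t x => ‖v t x‖ₑ ^ 2) (hBm.enorm.pow_const _), prod_restrict_eq_restrict_cylinder]
    exact (lintegral_mono_set (prod_mono Subset.rfl hBc)).trans_lt (h.sqIntegrable _ (isCompact_closedBall _ _))
  have hIG : ∫⁻ t, (∫⁻ x in B, ‖G t x‖ₑ ^ 2) ∂((volume : Measure ℝ).restrict (Ioo 0 T)) < ∞ := by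
    have hGB := h.lintegral_eLpNorm_grad_slice_lt_top hG (isCompact_closedBall (0 : EuclideanSpace ℝ (Fin 3)) n)
    have h1 := lintegral_eLpNorm_slice_rpow_eq (hG.aestronglyMeasurable_prod_restrict (closedBall (0 : EuclideanSpace ℝ (Fin 3)) n))
      two_ne_zero ENNReal.ofNat_ne_top
    rw [ENNReal.toReal_ofNat] at h1
    rw [h1] at hGB
    rw [lintegral_lintegral (f := fun t x => ‖G t x‖ₑ ^ 2) (hGBm.enorm.pow_const _), prod_restrict_eq_restrict_cylinder]
    rw [prod_restrict_eq_restrict_cylinder] at hGB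
    refine (lintegral_mono_set (prod_mono Subset.rfl hBc)).trans_lt ?_
    refine lt_of_le_of_lt (lintegral_mono fun z => le_of_eq ?_) hGB
    rw [ENNReal.rpow_two]; rfl
  have hmv : AEMeasurable (fun t => ∫⁻ x in B, ‖v t x‖ₑ ^ 2) ((volume : Measure ℝ).restrict (Ioo 0 T)) :=
    (hBm.enorm.pow_const 2).lintegral_prod_right'
  have hmG : AEMeasurable (fun t => ∫⁻ x in B, ‖G t x‖ₑ ^ 2) ((volume : Measure ℝ).restrict (Ioo 0 T)) :=
    (hGBm.enorm.pow_const 2).lintegral_prod_right'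
  calc ∫⁻ t, eLpNorm (v t) 6 ((volume : Measure (EuclideanSpace ℝ (Fin 3))).restrict K) ^ (2 : ℝ)
        ∂((volume : Measure ℝ).restrict (Ioo 0 T))
      ≤ ∫⁻ t, 4 * (C : ℝ≥0∞) ^ (2 : ℝ) * ((∫⁻ x in B, ‖v t x‖ₑ ^ 2) + 3 * ∫⁻ x in B, ‖G t x‖ₑ ^ 2)
          ∂((volume : Measure ℝ).restrict (Ioo 0 T)) := lintegral_mono_ae hslice
    _ = 4 * (C : ℝ≥0∞) ^ (2 : ℝ) * ((∫⁻ t, (∫⁻ x in B, ‖v t x‖ₑ ^ 2) ∂((volume : Measure ℝ).restrict (Ioo 0 T))) +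
          3 * ∫⁻ t, (∫⁻ x in B, ‖G t x‖ₑ ^ 2) ∂((volume : Measure ℝ).restrict (Ioo 0 T))) := by
        have hsum : AEMeasurable (fun t => (∫⁻ x in B, ‖v t x‖ₑ ^ 2) + 3 * ∫⁻ x in B, ‖G t x‖ₑ ^ 2)
            ((volume : Measure ℝ).restrict (Ioo 0 T)) := hmv.add (hmG.const_mul _)
        rw [lintegral_const_mul'' _ hsum, lintegral_add_left' hmv, lintegral_const_mul'' _ hmG]
    _ < ∞ := by
        refine ENNReal.mul_lt_top (ENNReal.mul_lt_top (by simp) ?_) ?_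
        · exact ENNReal.rpow_lt_top_of_nonneg (by norm_num) ENNReal.coe_ne_top
        · exact ENNReal.add_lt_top.2 ⟨hIv, ENNReal.mul_lt_top (by simp) hIG⟩

end IsLocalLeraySolutionOn

/-! ## The regular solution: slice bounds from the splitting `u₁ = u₃ + u₄` -/

/-- The `L³` slice bound of the rough part transfers to `u₁ - u₃`: if `u₁ = u₃ + u₄` a.e. on the
slab and `‖u₄(t)‖_{L³} ≤ ε` for a.e. `t`, then `‖(u₁ - u₃)(t)‖_{L³(K)} ≤ ε` for a.e. `t`
(Fubini). [folklore] -/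
theorem ae_eLpNorm_sub_slice_three_le {T : ℝ}
    {u₁ u₃ u₄ : ℝ → EuclideanSpace ℝ (Fin 3) → EuclideanSpace ℝ (Fin 3)}
    (hsplit : uncurry u₁ =ᵐ[(volume : Measure (ℝ × EuclideanSpace ℝ (Fin 3))).restrict (Ioo 0 T ×ˢ univ)]
      fun z => u₃ z.1 z.2 + u₄ z.1 z.2)
    {ε : ℝ} (hε : ∀ᵐ t ∂((volume : Measure ℝ).restrict (Ioo 0 T)), eLpNorm (u₄ t) 3 volume ≤ ENNReal.ofReal ε)
    (K : Set (EuclideanSpace ℝ (Fin 3))) :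
    ∀ᵐ t ∂((volume : Measure ℝ).restrict (Ioo 0 T)),
      eLpNorm (fun x => u₁ t x - u₃ t x) 3 ((volume : Measure (EuclideanSpace ℝ (Fin 3))).restrict K) ≤
        ENNReal.ofReal ε := by
  rw [volume_restrict_slab_eq] at hsplit
  have h1 : ∀ᵐ t ∂((volume : Measure ℝ).restrict (Ioo 0 T)), ∀ᵐ x ∂(volume : Measure (EuclideanSpace ℝ (Fin 3))),
      uncurry u₁ (t, x) = u₃ (t, x).1 (t, x).2 + u₄ (t, x).1 (t, x).2 :=
    Measure.ae_ae_of_ae_prod hsplit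
  filter_upwards [h1, hε] with t ht hεt
  calc eLpNorm (fun x => u₁ t x - u₃ t x) 3 ((volume : Measure (EuclideanSpace ℝ (Fin 3))).restrict K)
      ≤ eLpNorm (fun x => u₁ t x - u₃ t x) 3 volume := eLpNorm_mono_measure _ Measure.restrict_le_self
    _ = eLpNorm (u₄ t) 3 volume := by
        refine eLpNorm_congr_ae ?_
        filter_upwards [ht] with x hx
        simp only [uncurry] at hx
        rw [hx, add_sub_cancel_left]
    _ ≤ ENNReal.ofReal ε := hεt

/-- The `L^∞` slice bound of the smooth part restricts to `K`. [folklore] -/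
theorem ae_eLpNorm_slice_top_restrict_le {T : ℝ} {u₃ : ℝ → EuclideanSpace ℝ (Fin 3) → EuclideanSpace ℝ (Fin 3)}
    {m : ℝ → ℝ} (hm : ∀ᵐ t ∂((volume : Measure ℝ).restrict (Ioo 0 T)), eLpNorm (u₃ t) ∞ volume ≤ ENNReal.ofReal (m t))
    (K : Set (EuclideanSpace ℝ (Fin 3))) :
    ∀ᵐ t ∂((volume : Measure ℝ).restrict (Ioo 0 T)),
      eLpNorm (u₃ t) ∞ ((volume : Measure (EuclideanSpace ℝ (Fin 3))).restrict K) ≤ ‖m t‖ₑ := by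
  filter_upwards [hm] with t ht
  refine (eLpNorm_mono_measure _ Measure.restrict_le_self).trans (ht.trans ?_)
  rw [Real.enorm_eq_ofReal_abs]
  exact ENNReal.ofReal_le_ofReal (le_abs_self _)

/-- From `∫_{(0,T)} m² < ∞`: the weight `t ↦ ‖m t‖ₑ` is a.e.-measurable with `∫ ‖m‖ₑ² < ∞`.
[folklore] -/
theorem aemeasurable_enorm_and_lintegral_sq_lt_top_of_integrableOn_sq {T : ℝ} {m : ℝ → ℝ}
    (hm : IntegrableOn (fun t => m t ^ 2) (Ioo 0 T) volume) :
    AEMeasurable (fun t => ‖m t‖ₑ) ((volume : Measure ℝ).restrict (Ioo 0 T)) ∧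
      ∫⁻ t, ‖m t‖ₑ ^ (2 : ℝ) ∂((volume : Measure ℝ).restrict (Ioo 0 T)) < ∞ := by
  have heq : ∀ t, ‖m t‖ₑ = ‖m t ^ 2‖ₑ ^ (1 / 2 : ℝ) := fun t => by
    rw [enorm_pow, ← ENNReal.rpow_natCast, ← ENNReal.rpow_mul]
    norm_num
  have h1 : AEMeasurable (fun t => ‖m t‖ₑ) ((volume : Measure ℝ).restrict (Ioo 0 T)) := by
    have := (hm.aestronglyMeasurable.enorm.pow_const (1 / 2 : ℝ))
    exact this.congr (Eventually.of_forall fun t => (heq t).symm)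
  refine ⟨h1, ?_⟩
  have h2 := hm.2
  rw [hasFiniteIntegral_iff_enorm] at h2
  refine lt_of_le_of_lt (lintegral_mono fun t => le_of_eq ?_) h2
  rw [ENNReal.rpow_two, ← enorm_pow]

end Literature.Analysis.FluidPDE
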